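import Summits.AtomisticToContinuum.BoseEinsteinCondensation.Theorems.BECGroundStateSOSPeriodicIRBoundTwoSectorFloatingDefs
import HarnessLib

/-!
# Route `BECGroundStateSOS`, crux `PeriodicIRBound` (stmt-AtomisticToContinuum-3972), line `two-sector-gd-transfer`
# (v8 "floating thresholds") — the all-`Φ` floating threshold is pinned at `E₀(N+1)`

Supports (does not close) stmt-AtomisticToContinuum-3972. The registered by-product stub
`stub_pinnedThresholdOfAllPhi`, the obstruction lemma behind the v7/v8 design (first remark of the module docstring
of `…TwoSectorFloatingDefs.lean`): a regularised particle-channel susceptibility bound of the shape of `SuscPlus`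
but with a FREE threshold `T` in place of `E₀(N+1)`, required for EVERY finite-energy `(N+1)`-body state `Φ`, can only
hold if `T ≤ E₀(N+1)`. Indeed the left side is a square, hence `≥ 0`, while testing at a near-ground state `Φ` of
`H_{N+1}` (which exists because `E₀(N+1) < ⊤` is an infimum over trial states) makes the right side
`b((1+η)(E(Φ) − T) + η)` negative as soon as `T > E₀(N+1)` and `η` is small against the overshoot `T − E₀(N+1)`.
Pure order / real arithmetic over the tree's definitions; nothing is cited as a fact.
-/

noncomputable section

open scoped BigOperators ENNReal
open Filter MeasureTheory

namespace Summit.AtomisticToContinuum.BoseEinsteinCondensation.Cruxes.PeriodicIRBound.TwoSectorGdTransfer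

open Literature.MathematicalPhysics.QuantumManyBody.BoseGas

/-- **A finite infimum is approached**: if `E₀^per(N, L) ≠ ⊤` then for every slack `δ > 0` some periodic trial state
has energy `< E₀^per(N, L) + δ` (`periodicGroundStateEnergy` is `⨅ Ψ, periodicEnergy v Ψ`; `iInf_lt_iff`). [folklore] -/
theorem PinnedThreshold.exists_periodicEnergy_lt (v : ℝ → ℝ≥0∞) (N : ℕ) (L : ℝ) {δ : ℝ≥0∞}
    (hE : periodicGroundStateEnergy v N L ≠ ⊤) (hδ : 0 < δ) :
    ∃ Ψ : PeriodicTrialState N L, periodicEnergy v Ψ < periodicGroundStateEnergy v N L + δ :=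
  iInf_lt_iff.1 (ENNReal.lt_add_right hE hδ.ne')

/-- **Real arithmetic of the obstruction**: with overshoot `s > 0`, regulariser `η = s/2`, a test energy
`E < e₃ + s/4` and threshold `T = e₃ + s`, the right side `b((1 + s/2)(E − T) + s/2)` is negative for `b > 0`,
so it cannot dominate a square. [folklore] -/
theorem PinnedThreshold.arith {b s e3 E T x : ℝ} (hb : 0 < b) (hs : 0 < s) (hT : T = e3 + s)
    (hE : E < e3 + s / 4) (hkey : x ^ 2 ≤ b * ((1 + s / 2) * (E - T) + s / 2)) : False := by
  have hsq : 0 ≤ x ^ 2 := sq_nonneg x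
  have hdiff : E - T < -(3 * s / 4) := by linarith
  have hprod : (1 + s / 2) * (E - T) < (1 + s / 2) * (-(3 * s / 4)) :=
    mul_lt_mul_of_pos_left hdiff (by linarith)
  have hneg : (1 + s / 2) * (E - T) + s / 2 < 0 := by nlinarith [mul_pos hs hs]
  have hbneg : b * ((1 + s / 2) * (E - T) + s / 2) < 0 := mul_neg_of_pos_of_neg hb hneg
  linarith

/-- **Registered by-product `stub_pinnedThresholdOfAllPhi` of the crux ledger** (line `two-sector-gd-transfer`, v8):
an all-`Φ` regularised particle-channel susceptibility bound (the shape of `SuscPlus`, threshold `T` free) forces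
`T ≤ E₀^per(N+1, L)`. Proof: if `e₃ := E₀(N+1).toReal < T`, put `s := T − e₃ > 0`, `η := s/2`; the hypothesis yields
`δ > 0`; a `δ`-near-minimiser `Ψ` of `H_N` and a state `Φ` of `H_{N+1}` with `E(Φ) < E₀(N+1) + s/4` exist since both
ground-state energies are finite infima (`PinnedThreshold.exists_periodicEnergy_lt`); then the bound at `(Ψ, Φ)` reads
`square ≤ b((1 + s/2)(E(Φ) − T) + s/2) < 0` (`PinnedThreshold.arith`), absurd. [folklore] -/
theorem stub_pinnedThresholdOfAllPhi : ∀ (v : ℝ → ℝ≥0∞) (N : ℕ) (L : ℝ) (n : Fin 3 → ℤ) (b T : ℝ), 0 < b →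
    periodicGroundStateEnergy v N L ≠ ⊤ → periodicGroundStateEnergy v (N + 1) L ≠ ⊤ →
    (∀ η : ℝ, 0 < η → ∃ δ : ℝ≥0∞, 0 < δ ∧ ∀ Ψ : PeriodicTrialState N L, NearMinAt v δ Ψ →
      ∀ Φ : PeriodicTrialState (N + 1) L, periodicEnergy v Φ ≠ ⊤ →
        (Real.sqrt ((N : ℝ) + 1) * transferIntegralRe L n Ψ.ψ Φ.ψ) ^ 2 ≤
          b * ((1 + η) * ((periodicEnergy v Φ).toReal - T) + η)) →
    T ≤ (periodicGroundStateEnergy v (N + 1) L).toReal := by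
  intro v N L n b T hb hE0 hE1 h
  refine not_lt.1 fun hlt => ?_
  -- the overshoot `s = T - e₃ > 0`
  obtain ⟨s, hs, hT⟩ : ∃ s : ℝ, 0 < s ∧ T = (periodicGroundStateEnergy v (N + 1) L).toReal + s :=
    ⟨T - (periodicGroundStateEnergy v (N + 1) L).toReal, by linarith, by ring⟩
  -- the hypothesis at `η = s/2`
  obtain ⟨δ, hδ, hΨ⟩ := h (s / 2) (by linarith)
  -- a `δ`-near-minimiser of `H_N`
  obtain ⟨Ψ, hΨlt⟩ := PinnedThreshold.exists_periodicEnergy_lt v N L hE0 hδ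
  have hnear : NearMinAt v δ Ψ := hΨlt.le
  -- a near-ground state of `H_{N+1}` with energy `< E₀(N+1) + s/4`
  have hε : (0 : ℝ≥0∞) < ENNReal.ofReal (s / 4) := ENNReal.ofReal_pos.2 (by linarith)
  obtain ⟨Φ, hΦlt⟩ := PinnedThreshold.exists_periodicEnergy_lt v (N + 1) L hE1 hε
  have hΦne : periodicEnergy v Φ ≠ ⊤ := hΦlt.ne_top
  have htop : periodicGroundStateEnergy v (N + 1) L + ENNReal.ofReal (s / 4) ≠ ⊤ :=
    ENNReal.add_ne_top.2 ⟨hE1, ENNReal.ofReal_ne_top⟩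
  have hΦreal : (periodicEnergy v Φ).toReal < (periodicGroundStateEnergy v (N + 1) L).toReal + s / 4 := by
    have h1 := ENNReal.toReal_strict_mono htop hΦlt
    rwa [ENNReal.toReal_add hE1 ENNReal.ofReal_ne_top, ENNReal.toReal_ofReal (by linarith)] at h1
  -- the bound at `(Ψ, Φ)` is absurd
  exact PinnedThreshold.arith hb hs hT hΦreal (hΨ Ψ hnear Φ hΦne)

end Summit.AtomisticToContinuum.BoseEinsteinCondensation.Cruxes.PeriodicIRBound.TwoSectorGdTransfer

end
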